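import Summits.AnomalousDissipation.AnomalousDissipation.Theses.VirtualDissipation
import Summits.AnomalousDissipation.AnomalousDissipation.Theorems.LightSteadyStatesGP.Negative.RigidityCap

/-!
# Crux `LightSteadyStatesGP` (stmt-AnomalousDissipation-15151, route VirtualDissipation, rank 3) —
# strategist census r1: the WITNESS DICHOTOMY that places the crux (second opinion, 2026-08-17)

Sorry-free.  Four statements, all about the crux's OWN witnesses (classical steady states of `NS_ν(f_GP)`,
mean zero, `∫|u|² ≤ 2`, along `ν_j → 0`):

* `SteadyFrozenTurbulenceGP` — the crux's witnesses with a ν-uniform dissipation floor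
  `ε₀ ≤ ν_j‖∇u_j‖₂²`: this is a STEADY SUMMIT WITNESS at the pinned force and level
  (`anomalousDissipation_of_frozen : SteadyFrozenTurbulenceGP → AnomalousDissipation`, the tail of the
  route's `closes` with the floor as a hypothesis instead of `LambRigidGP`).
* `QuietLightGP` — light mean-zero classical steady states of `f_GP` with arbitrarily small viscosity AND
  arbitrarily small dissipation: an exact Onsager-dodger family in the 2-ball, which REFUTES the sibling crux
  (`not_lambRigidGP_of_quiet : QuietLightGP → ¬ LambRigidGP`, by the landed residual transfer
  `Negative.RigidityCap.residual_le`: `R = ν‖∇u‖₂`, `R² = ν·ε`).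
* `crux_dichotomy : LightSteadyStatesGP → SteadyFrozenTurbulenceGP ∨ QuietLightGP` (pure logic on the
  witness sequence: either some tail is uniformly loud, or quiet light states occur at arbitrarily small ν).
* hence `frozen_of_lambRigidGP : LambRigidGP → LightSteadyStatesGP → SteadyFrozenTurbulenceGP` and
  `crux_iff_frozen_of_lambRigidGP : LambRigidGP → (LightSteadyStatesGP ↔ SteadyFrozenTurbulenceGP)`.

Reading (census r1, §Bottom line): INSIDE its route the crux has no content short of the summit — every
witness is either a steady summit witness for `(f_GP, level 2)` or kills the route through its other crux
(kill criterion (i) of the route header).  A loudness-agnostic existence proof (degree / continuation behind a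
wall, lines `birth`, `Sketch` S7, idea `ekman-homotopy`) would prove the crux without deciding the disjunct;
the census explains why no such proof has a tool behind its wall.
-/

set_option linter.dupNamespace false

noncomputable section

open MeasureTheory Set Filter Topology
open scoped InnerProductSpace RealInnerProductSpace

namespace Summit.AnomalousDissipation.AnomalousDissipation.Cruxes.LightSteadyStatesGP.CensusR1

open Literature.Analysis.FunctionSpaces Literature.Analysis.FunctionSpaces.Torus
open Literature.Analysis.FluidPDE Literature.Analysis.FluidPDE.Torus
open Summit.AnomalousDissipation.AnomalousDissipation.Theorems.EnsembleRigidity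
open Summit.AnomalousDissipation.AnomalousDissipation.Theorems.EnsembleRigidity.GPStatisticalRigidity
open Summit.AnomalousDissipation.AnomalousDissipation.Theorems.LightSteadyStatesGP.Negative
open Summit.AnomalousDissipation.AnomalousDissipation.Theses.VirtualDissipation

/-! ## §0 Vocabulary -/

/-- `(u,p)` is a classical steady state of `NS_ν(f_GP)` (the crux's clause; `gpForce` is the crux's inline
force by `rfl`, `gpForce_eq`). [folklore] -/
abbrev IsSteadyGP (ν : ℝ) (u : UnitAddTorus (Fin 3) → EuclideanSpace ℝ (Fin 3))
    (p : UnitAddTorus (Fin 3) → ℝ) : Prop :=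
  IsClassicalNSSolutionOn Set.univ ν (fun _ => gpForce) (fun _ => u) (fun _ => p)

/-- **Steady frozen turbulence of `f_GP` in the 2-ball**: the crux's witnesses (light, mean-zero, classical
steady states along `ν_j → 0` in `(0,1]`) with a ν-UNIFORM DISSIPATION FLOOR `ε₀ ≤ ν_j‖∇u_j‖₂²`.
This is the steady species of summit witness at the pinned force and level. [folklore] -/
def SteadyFrozenTurbulenceGP : Prop :=
  ∃ (ν : ℕ → ℝ) (u : ℕ → UnitAddTorus (Fin 3) → EuclideanSpace ℝ (Fin 3)) (p : ℕ → UnitAddTorus (Fin 3) → ℝ),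
    (∀ j, 0 < ν j ∧ ν j ≤ 1) ∧ Tendsto ν atTop (𝓝 0) ∧ (∀ j, IsSteadyGP (ν j) (u j) (p j)) ∧
    (∀ j, HasZeroMean (u j)) ∧ (∀ j, ∫ x, ‖u j x‖ ^ 2 ≤ 2) ∧
    ∃ ε₀ : ℝ, 0 < ε₀ ∧ ∀ j, ε₀ ≤ ν j * gradNormSq (u j)

/-- **Quiet light states at arbitrarily small viscosity**: for every `ε₀ > 0` a light mean-zero classical
steady state of `NS_ν(f_GP)` with `0 < ν < ε₀` AND dissipation `ν‖∇u‖₂² < ε₀`.  Such a family is an exact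
Onsager-dodger family of `f_GP` in the 2-ball (residual `R = ν‖∇u‖₂ → 0` with `R‖∇u‖₂ = ν‖∇u‖₂² → 0`). [folklore] -/
def QuietLightGP : Prop :=
  ∀ ε₀ : ℝ, 0 < ε₀ → ∃ (ν : ℝ) (u : UnitAddTorus (Fin 3) → EuclideanSpace ℝ (Fin 3)) (p : UnitAddTorus (Fin 3) → ℝ),
    0 < ν ∧ ν < ε₀ ∧ IsSteadyGP ν u p ∧ HasZeroMean u ∧ ∫ x, ‖u x‖ ^ 2 ≤ 2 ∧ ν * gradNormSq u < ε₀

/-! ## §1 The dichotomy -/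

/-- **Witness dichotomy** (pure logic): a witness sequence of the crux either has a uniformly loud tail
(`SteadyFrozenTurbulenceGP`) or exhibits quiet light states at arbitrarily small viscosity (`QuietLightGP`).
[folklore] -/
theorem crux_dichotomy (hC : LightSteadyStatesGP) : SteadyFrozenTurbulenceGP ∨ QuietLightGP := by
  by_cases hq : QuietLightGP
  · exact Or.inr hq
  left
  simp only [QuietLightGP, not_forall, not_exists, not_and, not_lt, exists_prop] at hq
  obtain ⟨ε₀, hε₀, hloud⟩ := hq
  obtain ⟨ν, u, p, hν, hν0, hsol, hmean, hE⟩ := hC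
  -- a tail of the sequence lies below ε₀; on it every witness is loud by ¬QuietLightGP
  obtain ⟨N, hN⟩ := ((tendsto_order.1 hν0).2 ε₀ hε₀).exists_forall_of_atTop
  refine ⟨fun j => ν (j + N), fun j => u (j + N), fun j => p (j + N), fun j => hν _,
    hν0.comp (tendsto_add_atTop_nat N), fun j => hsol _, fun j => hmean _, fun j => hE _, ε₀, hε₀, fun j => ?_⟩
  exact hloud (ν (j + N)) (u (j + N)) (p (j + N)) (hν _).1 (hN _ (Nat.le_add_left N j)) (hsol _) (hmean _) (hE _)

/-- Conversely and trivially, steady frozen turbulence witnesses the crux (drop the floor). [folklore] -/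
theorem crux_of_frozen (h : SteadyFrozenTurbulenceGP) : LightSteadyStatesGP := by
  obtain ⟨ν, u, p, hν, hν0, hsol, hmean, hE, -⟩ := h
  exact ⟨ν, u, p, hν, hν0, hsol, hmean, hE⟩

/-! ## §2 The loud disjunct is a summit witness -/

/-- **Steady frozen turbulence of `f_GP` ⇒ `AnomalousDissipation`**: constant-in-time classical states are global
Leray–Hopf solutions whose long-time means are their slice values (the tail of the route's `closes`, with the
dissipation floor now a hypothesis instead of being derived from `LambRigidGP`). [folklore] -/
theorem anomalousDissipation_of_frozen (h : SteadyFrozenTurbulenceGP) : _root_.AnomalousDissipation := by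
  obtain ⟨ν, u, p, hν, hν0, hsol, -, hlight, ε₀, hε₀, hfloor⟩ := h
  obtain ⟨hfs, hfd, hfz⟩ : IsSmooth gpForce ∧ IsDivFree gpForce ∧ HasZeroMean gpForce :=
    Summit.AnomalousDissipation.AnomalousDissipation.Theorems.SteadyStatesLoudBounded.GpAdmissible.stub_gpAdmissible
  have hus : ∀ j, IsSmooth (u j) := fun j => (hsol j).smooth_velocity.isSmooth_slice (Set.mem_univ (0 : ℝ))
  refine ⟨gpForce, hfs, hfd, hfz, ν, fun j => u j, fun j _ => u j, fun j => (hν j).1, hν0,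
    fun j => (hsol j).isGlobalLerayHopf, ⟨2, fun j => ?_⟩, ε₀, hε₀, fun j => ?_⟩
  · rw [Literature.Analysis.FluidPDE.meanEnergy_eq_of_periodic (τ := 1) (fun _ => rfl) one_pos]
    simpa using hlight j
  · rw [Literature.Analysis.FluidPDE.meanDissipation_eq_of_periodic (τ := 1) (fun _ => rfl) one_pos]
    have h := hfloor j
    rw [gradNormSq_eq_toReal_eGradNormSq_holds (hus j)] at h
    simpa using h

/-! ## §3 The quiet disjunct kills the route through the sibling crux -/

/-- **Quiet light states refute Lamb rigidity of `f_GP` at every level `E ≥ 2`**: a quiet light state with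
`ν < ε₀`, `ν‖∇u‖₂² < ε₀`, `ε₀ ≤ min(c, δ₀, 1)`, has residual bound `R = ν‖∇u‖₂` (landed
`Negative.RigidityCap.residual_le`) with `R² = ν·(ν‖∇u‖₂²) < ε₀² ≤ δ₀²`, so rigidity would give
`c ≤ R‖∇u‖₂ = ν‖∇u‖₂² < ε₀ ≤ c`. [folklore] -/
theorem not_lambRigidGP_of_quiet (hq : QuietLightGP) : ¬ LambRigidGP := by
  rintro ⟨E, c, δ₀, hE2, hc, hδ₀, hrig⟩
  set ε₀ : ℝ := min (min c δ₀) 1 with hε₀def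
  have hε₀ : 0 < ε₀ := lt_min (lt_min hc hδ₀) one_pos
  have hε₀c : ε₀ ≤ c := (min_le_left _ _).trans (min_le_left _ _)
  have hε₀δ : ε₀ ≤ δ₀ := (min_le_left _ _).trans (min_le_right _ _)
  obtain ⟨ν, u, p, hνpos, hνlt, hsol, hmean, hlight, hquiet⟩ := hq ε₀ hε₀
  have hus : IsSmooth u := hsol.smooth_velocity.isSmooth_slice (Set.mem_univ (0 : ℝ))
  have hud : IsDivFree u := hsol.divFree 0 (Set.mem_univ _)
  set G := gradNormSq u with hGdef
  have hG : 0 ≤ G := gradNormSq_nonneg _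
  set R := ν * Real.sqrt G with hRdef
  have hR0 : 0 ≤ R := mul_nonneg hνpos.le (Real.sqrt_nonneg _)
  have hRG : R * Real.sqrt G = ν * G := by rw [hRdef, mul_assoc, Real.mul_self_sqrt hG]
  have hνG0 : 0 ≤ ν * G := mul_nonneg hνpos.le hG
  have hR2 : R ^ 2 = ν * (ν * G) := by rw [hRdef, mul_pow, Real.sq_sqrt hG]; ring
  have hRδ : R ≤ δ₀ := by
    have h1 : R ^ 2 < δ₀ ^ 2 := by
      rw [hR2]
      have h2 : ν * (ν * G) ≤ ν * ε₀ := mul_le_mul_of_nonneg_left hquiet.le hνpos.le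
      have h3 : ν * ε₀ < ε₀ * ε₀ := mul_lt_mul_of_pos_right hνlt hε₀
      have h4 : ε₀ * ε₀ ≤ δ₀ * δ₀ := mul_le_mul hε₀δ hε₀δ hε₀.le hδ₀.le
      nlinarith
    exact le_of_lt (lt_of_pow_lt_pow_left₀ 2 hδ₀.le h1)
  have key := hrig u hus hud hmean (hlight.trans hE2) R hR0 (RigidityCap.residual_le hνpos hsol) hRδ
  rw [hRG] at key
  linarith

/-! ## §4 Inside the route: the crux IS steady frozen turbulence of `f_GP` -/

/-- Under the sibling crux every witness sequence of the crux has a uniformly loud tail. [folklore] -/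
theorem frozen_of_lambRigidGP (hL : LambRigidGP) (hC : LightSteadyStatesGP) : SteadyFrozenTurbulenceGP :=
  (crux_dichotomy hC).resolve_right fun hq => not_lambRigidGP_of_quiet hq hL

/-- **Placement**: granted `LambRigidGP`, the crux is EQUIVALENT to steady frozen turbulence of `f_GP` in the
2-ball — a steady summit witness species (`anomalousDissipation_of_frozen`). [folklore] -/
theorem crux_iff_frozen_of_lambRigidGP (hL : LambRigidGP) : LightSteadyStatesGP ↔ SteadyFrozenTurbulenceGP :=
  ⟨frozen_of_lambRigidGP hL, crux_of_frozen⟩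

/-- The route's deciding theorem re-derived through the dichotomy (sanity: same content as `closes`). [folklore] -/
theorem anomalousDissipation_of_cruxes (hL : LambRigidGP) (hC : LightSteadyStatesGP) : _root_.AnomalousDissipation :=
  anomalousDissipation_of_frozen (frozen_of_lambRigidGP hL hC)

/-- **Without the sibling**: the crux alone yields the summit OR the death of the route. [folklore] -/
theorem summit_or_routeKill (hC : LightSteadyStatesGP) : _root_.AnomalousDissipation ∨ ¬ LambRigidGP :=
  (crux_dichotomy hC).imp anomalousDissipation_of_frozen not_lambRigidGP_of_quiet


/-! ## §5 Typed census statements (r1 inventory; signatures that elaborate, glues proved where cheap)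

These are the `S⁺` / split signatures discussed under the census headings.  None is registered as a line:
each is either the crux again (costume), summit-strength, or tool-less — the census says which and why. -/

/-- A light mean-zero classical steady state of `NS_ν(f_GP)` exists at viscosity `ν`. [folklore] -/
def LightAt (ν : ℝ) : Prop :=
  ∃ (u : UnitAddTorus (Fin 3) → EuclideanSpace ℝ (Fin 3)) (p : UnitAddTorus (Fin 3) → ℝ),
    IsSteadyGP ν u p ∧ HasZeroMean u ∧ ∫ x, ‖u x‖ ^ 2 ≤ 2

/-- **Strengthen-to-induct (RG step)**: a base viscosity `ν₀ ∈ (0,1]` carrying a light state, and a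
PROPAGATION step "light at `ν` ⇒ light at `ν/2`" for all `ν ≤ ν₀`.  The base is CAP-grade (indeed a theorem
for `ν₀ ≥ √3/(8π²)`, `Negative.AprioriRegime`); the step is an inductive construction of one more octave of
cascade per halving — summit-strength (census §Strengthen S-r1-2). [folklore] -/
def PropagationStep : Prop :=
  ∃ ν₀ : ℝ, 0 < ν₀ ∧ ν₀ ≤ 1 ∧ LightAt ν₀ ∧ ∀ ν : ℝ, 0 < ν → ν ≤ ν₀ → LightAt ν → LightAt (ν / 2)

/-- The RG-step strengthening implies the crux (light states on the lattice `ν₀ 2^{-k} → 0`). [folklore] -/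
theorem crux_of_propagationStep (h : PropagationStep) : LightSteadyStatesGP := by
  obtain ⟨ν₀, hν₀, hν₀1, hbase, hstep⟩ := h
  -- light states along the dyadic lattice
  have hlat : ∀ k : ℕ, LightAt (ν₀ / 2 ^ k) := by
    intro k
    induction k with
    | zero => simpa using hbase
    | succ k ih =>
      have hpos : 0 < ν₀ / 2 ^ k := by positivity
      have hle : ν₀ / 2 ^ k ≤ ν₀ := div_le_self hν₀.le (one_le_pow₀ (by norm_num))
      have h := hstep (ν₀ / 2 ^ k) hpos hle ih
      have heq : ν₀ / 2 ^ k / 2 = ν₀ / 2 ^ (k + 1) := by rw [pow_succ, div_div]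
      rwa [heq] at h
  choose u p hsol hmean hE using hlat
  refine ⟨fun k => ν₀ / 2 ^ k, u, p, fun k => ⟨by positivity, ?_⟩, ?_, fun k => hsol k, hmean, hE⟩
  · exact (div_le_self hν₀.le (one_le_pow₀ (by norm_num))).trans hν₀1
  · -- `ν₀ / 2^k → 0`
    have h2 : Tendsto (fun k : ℕ => ((1 : ℝ) / 2) ^ k) atTop (𝓝 0) :=
      tendsto_pow_atTop_nhds_zero_of_lt_one (by norm_num) (by norm_num)
    have h3 : Tendsto (fun k : ℕ => ν₀ * ((1 : ℝ) / 2) ^ k) atTop (𝓝 (ν₀ * 0)) := h2.const_mul ν₀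
    rw [mul_zero] at h3
    refine h3.congr' (Eventually.of_forall fun k => ?_)
    rw [div_pow, one_pow, mul_one_div]

/-- **K41 tail bound in the crystallographic class** (`S⁺` of census §Strengthen S-r1-3): for `G`-symmetric
classical steady states the energy OUTSIDE the forcing shell is controlled by the dissipation at the Kolmogorov
rate, `E_tail³ ≤ K ε²` (`ε = ν‖∇u‖₂²`; `E_tail = ∫|u|² − ∫|P₁u|²`, `P₁ = Torus.fourierTruncate 1`).  With the
landed energy–work law `∫|P₁u|² = (2/3)ε²` and anti-laminar law `∫|P₁u|² ≤ C(E_tail + ν²)` it forces a ν-UNIFORM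
bound on `ε` and hence on the energy of EVERY symmetric steady state (a symmetric ceiling) — the positive-Onsager /
K41-for-steady-states statement; no tool (census). [folklore] -/
def TailBoundG : Prop :=
  ∃ K : ℝ, 0 < K ∧ ∀ (ν : ℝ) (u : UnitAddTorus (Fin 3) → EuclideanSpace ℝ (Fin 3)) (p : UnitAddTorus (Fin 3) → ℝ),
    0 < ν → ν ≤ 1 → IsSteadyGP ν u p → HasZeroMean u → IsGPSymmetric u →
      ((∫ x, ‖u x‖ ^ 2) - ∫ x, ‖fourierTruncate 1 u x‖ ^ 2) ^ 3 ≤ K * (ν * gradNormSq u) ^ 2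

/-- **Approximate light steady states with a prescribed residual** (census §Strengthen S-r1-1, the least-squares /
Hopf-functional reformulation): at viscosity `ν` there is a light smooth divergence-free mean-zero `u` whose
steady Navier–Stokes residual `w ↦ ∫⟪(u·∇)u − νΔu − f_GP, w⟫` is bounded by `δ‖∇w‖₂` on smooth divergence-free
mean-zero tests.  At FIXED `ν > 0`, "`∀ δ > 0, ApproxLightAt ν δ`" is equivalent to `LightAt ν` (near-zeros are
`V`-bounded by `ν‖∇u‖₂² ≤ √3 + δ‖∇u‖₂`, Rellich, Temam regularity — not formalised here), so the crux is
"`inf residual = 0` infinitely often"; frustrated minimisers of the residual cannot be excluded (census). [folklore] -/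
def ApproxLightAt (ν δ : ℝ) : Prop :=
  ∃ u : UnitAddTorus (Fin 3) → EuclideanSpace ℝ (Fin 3), IsSmooth u ∧ IsDivFree u ∧ HasZeroMean u ∧
    ∫ x, ‖u x‖ ^ 2 ≤ 2 ∧
    ∀ w : UnitAddTorus (Fin 3) → EuclideanSpace ℝ (Fin 3), IsSmooth w → IsDivFree w → HasZeroMean w →
      |∫ x, ⟪convect u u x - ν • laplacian u x - gpForce x, w x⟫_ℝ| ≤ δ * Real.sqrt (gradNormSq w)

/-- The trivial direction: an exact light steady state is a residual-`δ` approximate one for every `δ ≥ 0`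
(its residual functional is `w ↦ ∫⟪∇p, w⟫ = 0`). [folklore] -/
theorem approxLightAt_of_lightAt {ν δ : ℝ} (hδ : 0 ≤ δ) (h : LightAt ν) : ApproxLightAt ν δ := by
  obtain ⟨u, p, hsol, hmean, hE⟩ := h
  have hu : IsSmooth u := hsol.smooth_velocity.isSmooth_slice (Set.mem_univ (0 : ℝ))
  have hp : IsSmooth p := hsol.smooth_pressure.isSmooth_slice (Set.mem_univ (0 : ℝ))
  have hud : IsDivFree u := hsol.divFree 0 (Set.mem_univ _)
  refine ⟨u, hu, hud, hmean, hE, fun w hw hwd hwz => ?_⟩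
  have hpt : ∀ x, convect u u x - ν • laplacian u x - gpForce x = -Torus.gradient p x := by
    intro x
    have hm := hsol.momentum 0 (Set.mem_univ _) x
    have h0 : Torus.timeDerivWithin Set.univ (fun _ : ℝ => u) 0 x = 0 := by simp [Torus.timeDerivWithin]
    rw [h0, zero_add] at hm
    have hm' : convect u u x = ν • laplacian u x - Torus.gradient p x + gpForce x := hm
    rw [hm']
    abel
  simp_rw [hpt, inner_neg_left, integral_neg]
  rw [integral_inner_gradient_eq_zero_of_isDivFree hw hp hwd, neg_zero, abs_zero]
  positivity

end Summit.AnomalousDissipation.AnomalousDissipation.Cruxes.LightSteadyStatesGP.CensusR1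

end
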